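import Summits.BirchSwinnertonDyer.BirchSwinnertonDyer.Theorems.KolyvaginRoadThreePTDevissageShrinking
import Summits.BirchSwinnertonDyer.Rank1Residual.GaloisImage.SelmerGroupFinite
import HarnessLib

/-!
# The `H¹_{𝓤_S^*}`-inputs of the dévissage of Milne I Thm. 4.10(b) are exactly `Ш¹`-vanishings

Route `ThetaPartnerAtTwo`, crux K4 `SignedControlAtTwo` (stmt-BirchSwinnertonDyer-20309), line `eulerchar` v11; width seat
`bsd-wall-tp2-p3-w3` g7 (`--supports stmt-BirchSwinnertonDyer-20309`, helper).  Companion of the crux memo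
`Cruxes/SignedControlAtTwo/N2-LEVELS-VERDICT-w3g7.md` (audit of item (N2) «levels `2^k`, `k ≥ 2` on road (B)»).

bsd-stepL koly's `KolyvaginRoadThreePT.middleExact_of_extension` (the dévissage of Milne *ADT* I Thm. 4.10(b) along
`0 → M₁ → M₂ → M₃ → 0`) carries, besides the two `Ш²`-vanishings, the inputs
`hH₁` / `hH₃D`: «every class of `H¹(K, X)` (`X = M₁^D`, resp. `M₃^{DD}`) which is ZERO at the places of `S` and UNRAMIFIED off `S`
is zero».  This file records, for an arbitrary discrete module `X` over a number field `K`: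

* `sha_eq_bot_of_forall_eq_zero_of_unramifiedOutside` — **necessity, at ANY `S`**: that input forces `Ш¹(K, X) = 0`
  (a class vanishing at every place is zero on `S` and unramified off `S`);
* `exists_finset_forall_eq_zero_of_sha_eq_bot` — **sufficiency for all large `S`**: if `X` is finite, unramified outside a
  finite `S₁ ⊇ {v ∣ ∞}`, and `Ш¹(K, X) = 0`, then there is a finite `S₀ ⊇ S₁` such that the input holds at every finite `S ⊇ S₀`
  (koly's shrinking lemma `exists_finset_forall_eq_zero_of_finite` fed with n1011's finiteness of the Selmer group of the
  structure `(⊤ on S₁, unramified off S₁)`, Milne I Lemma 4.8 / NSW (8.3.20));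
* `forall_large_iff_sha_eq_bot` — the two combined: the input holds for all sufficiently large `S` iff `Ш¹(K, X) = 0`.

So on road (B) the `hH`-inputs for a COMPOSITE piece are genuine `Ш¹`-vanishing statements (for `E[2^k]`-towers:
`Ш¹(K, E[2^i]) = 0`), which fail in general at `p = 2` (Dvornicich–Zannier 2004, Creutz 2016; level-4 instrument in the memo).
THEOREMS ONLY; no case of Poitou–Tate or BSD is proved here; BSD is not proved by any of this.

References: [MilneADT2006] I §4, Lemma 4.8, Thm. 4.10(b); [NeukirchSchmidtWingberg2008] (8.3.20).
-/

noncomputable section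

open Function NumberField IsDedekindDomain
open scoped NumberField

universe u

set_option linter.dupNamespace false
set_option autoImplicit false

namespace Summit.BirchSwinnertonDyer.BirchSwinnertonDyer.Theorems.SignedEC.N2Levels

open Field
open Literature.NumberTheory.GaloisRepresentations Literature.NumberTheory.GaloisCohomology
open Literature.NumberTheory.GaloisRepresentations.DiscreteGaloisModule (unramifiedSubgroup SelmerStructure)
open Summit.BirchSwinnertonDyer.BirchSwinnertonDyer.Theorems.KolyvaginRoadThreePT
open Summit.BirchSwinnertonDyer.Rank1Residual.GaloisImage.SelmerFinite

variable {K : Type u} [Field K] [NumberField K]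
variable {X : Type u} [AddCommGroup X] [TopologicalSpace X] [DiscreteTopology X]

/-- **Necessity, at any `S`.**  If every class of `H¹(K, X)` which is zero at the places of `S` and unramified at the
finite places off `S` vanishes (the input `hH₁` / `hH₃D` of `KolyvaginRoadThreePT.middleExact_of_extension` for
`X = M₁^D` / `M₃^{DD}`), then `Ш¹(K, X) = 0`. [cite: MilneADT2006, Ch. I §4, Lemma 4.8] -/
theorem sha_eq_bot_of_forall_eq_zero_of_unramifiedOutside (ρ : DiscreteGaloisModule K X) (S : Finset (Place K))
    (hH : ∀ y : galoisCohomology ρ 1,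
      (∀ v ∈ S, galoisCohomology.localization ρ v 1 y = 0) →
      (∀ w : HeightOneSpectrum (𝓞 K), (Sum.inr w : Place K) ∉ S →
        galoisCohomology.localization ρ (Sum.inr w) 1 y ∈ unramifiedSubgroup (GaloisRep.toLocal w ρ) 1) →
      y = 0) :
    ρ.sha = ⊥ := by
  rw [eq_bot_iff]
  intro y hy
  rw [DiscreteGaloisModule.mem_sha_iff] at hy
  rw [AddSubgroup.mem_bot]
  refine hH y (fun v _ => hy v) (fun w _ => ?_)
  rw [hy]
  exact zero_mem _

/-- Element form of `sha_eq_bot_of_forall_eq_zero_of_unramifiedOutside`: under the same input, a class vanishing at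
every place is zero. [cite: MilneADT2006, Ch. I §4, Lemma 4.8] -/
theorem eq_zero_of_forall_localization_eq_zero_of_forall_eq_zero_of_unramifiedOutside (ρ : DiscreteGaloisModule K X)
    (S : Finset (Place K))
    (hH : ∀ y : galoisCohomology ρ 1,
      (∀ v ∈ S, galoisCohomology.localization ρ v 1 y = 0) →
      (∀ w : HeightOneSpectrum (𝓞 K), (Sum.inr w : Place K) ∉ S →
        galoisCohomology.localization ρ (Sum.inr w) 1 y ∈ unramifiedSubgroup (GaloisRep.toLocal w ρ) 1) →
      y = 0)
    (y : galoisCohomology ρ 1) (hy : ∀ v : Place K, galoisCohomology.localization ρ v 1 y = 0) : y = 0 := by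
  have h := sha_eq_bot_of_forall_eq_zero_of_unramifiedOutside ρ S hH
  have hmem : y ∈ ρ.sha := (DiscreteGaloisModule.mem_sha_iff ρ y).2 hy
  rw [h, AddSubgroup.mem_bot] at hmem
  exact hmem

/-- **Sufficiency, for all large `S`.**  If `X` is finite, unramified at the finite places off a finite `S₁ ⊇ {v ∣ ∞}`,
and `Ш¹(K, X) = 0`, then there is a finite `S₀ ⊇ S₁` such that for every finite `S ⊇ S₀` every class of `H¹(K, X)` zero on
`S` and unramified off `S` is zero (the shrinking lemma + finiteness of `H¹_𝓤(K, X)` for `𝓤 = (⊤ on S₁, unramified off S₁)`).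
[cite: MilneADT2006, Ch. I §4, Lemma 4.8] [cite: NeukirchSchmidtWingberg2008, (8.3.20)] -/
theorem exists_finset_forall_eq_zero_of_sha_eq_bot [Finite X] (ρ : DiscreteGaloisModule K X)
    (S₁ : Finset (Place K)) (hinf : ∀ w : InfinitePlace K, (Sum.inl w : Place K) ∈ S₁)
    (hur : ∀ v : HeightOneSpectrum (𝓞 K), (Sum.inr v : Place K) ∉ S₁ → GaloisRep.IsUnramifiedAt v ρ)
    (hsha : ρ.sha = ⊥) :
    ∃ S₀ : Finset (Place K), S₁ ⊆ S₀ ∧ ∀ S : Finset (Place K), S₀ ⊆ S →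
      ∀ y : galoisCohomology ρ 1,
        (∀ v ∈ S, galoisCohomology.localization ρ v 1 y = 0) →
        (∀ w : HeightOneSpectrum (𝓞 K), (Sum.inr w : Place K) ∉ S →
          galoisCohomology.localization ρ (Sum.inr w) 1 y ∈ unramifiedSubgroup (GaloisRep.toLocal w ρ) 1) →
        y = 0 := by
  classical
  -- the structure `(⊤ on S₁, unramified off S₁)` and the finiteness of its Selmer group
  let 𝓤 : SelmerStructure ρ := fun v =>
    match v with
    | Sum.inl _ => ⊤
    | Sum.inr w => if (Sum.inr w : Place K) ∈ S₁ then ⊤ else unramifiedSubgroup (GaloisRep.toLocal w ρ) 1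
  have h𝓤nS : ∀ w : HeightOneSpectrum (𝓞 K), (Sum.inr w : Place K) ∉ S₁ →
      𝓤 (Sum.inr w) = unramifiedSubgroup (GaloisRep.toLocal w ρ) 1 := fun w hw => by
    change (if (Sum.inr w : Place K) ∈ S₁ then ⊤ else unramifiedSubgroup (GaloisRep.toLocal w ρ) 1) = _
    rw [if_neg hw]
  have h𝓤S : ∀ v : Place K, v ∈ S₁ → 𝓤 v = ⊤ := fun v hv => by
    rcases v with w | w
    · rfl
    · change (if (Sum.inr w : Place K) ∈ S₁ then ⊤ else unramifiedSubgroup (GaloisRep.toLocal w ρ) 1) = _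
      rw [if_pos hv]
      rfl
  haveI hfin : Finite 𝓤.selmerGroup := finite_selmerGroup_of_isUnramifiedOutside ρ hur ⟨hinf, h𝓤nS⟩
  -- every class zero on `S₁` and unramified off `S₁` lies in the finite group `H¹_𝓤`
  refine exists_finset_forall_eq_zero_of_finite ρ S₁ (𝓤.selmerGroup : Set (galoisCohomology ρ 1))
    (Set.toFinite _) (fun y hyS hyur => ?_) (fun y _ hy => ?_)
  · change y ∈ 𝓤.selmerGroup
    rw [SelmerStructure.mem_selmerGroup_iff]
    intro v
    by_cases hv : v ∈ S₁
    · rw [h𝓤S v hv]; exact AddSubgroup.mem_top _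
    · rcases v with w | w
      · exact absurd (hinf w) hv
      · rw [h𝓤nS w hv]
        exact hyur w hv
  · have hmem : y ∈ ρ.sha := (DiscreteGaloisModule.mem_sha_iff ρ y).2 hy
    rw [hsha, AddSubgroup.mem_bot] at hmem
    exact hmem

/-- **The `hH`-input holds for all sufficiently large `S` iff `Ш¹(K, X) = 0`** (`X` finite, unramified off `S₁ ⊇ {v ∣ ∞}`).
This is the precise content of the inputs `hH₁` (`X = M₁^D`) and `hH₃D` (`X = M₃^{DD}`) of the dévissage
`KolyvaginRoadThreePT.middleExact_of_extension` on the road «prove `hE` at all large `S`, then shrink by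
`middleExact_canonical_of_superset`». [cite: MilneADT2006, Ch. I §4, Lemma 4.8, Thm. 4.10(b)] -/
theorem forall_large_iff_sha_eq_bot [Finite X] (ρ : DiscreteGaloisModule K X)
    (S₁ : Finset (Place K)) (hinf : ∀ w : InfinitePlace K, (Sum.inl w : Place K) ∈ S₁)
    (hur : ∀ v : HeightOneSpectrum (𝓞 K), (Sum.inr v : Place K) ∉ S₁ → GaloisRep.IsUnramifiedAt v ρ) :
    (∃ S₀ : Finset (Place K), S₁ ⊆ S₀ ∧ ∀ S : Finset (Place K), S₀ ⊆ S →
      ∀ y : galoisCohomology ρ 1,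
        (∀ v ∈ S, galoisCohomology.localization ρ v 1 y = 0) →
        (∀ w : HeightOneSpectrum (𝓞 K), (Sum.inr w : Place K) ∉ S →
          galoisCohomology.localization ρ (Sum.inr w) 1 y ∈ unramifiedSubgroup (GaloisRep.toLocal w ρ) 1) →
        y = 0) ↔ ρ.sha = ⊥ := by
  constructor
  · rintro ⟨S₀, -, hS₀⟩
    exact sha_eq_bot_of_forall_eq_zero_of_unramifiedOutside ρ S₀ (hS₀ S₀ subset_rfl)
  · exact exists_finset_forall_eq_zero_of_sha_eq_bot ρ S₁ hinf hur

end Summit.BirchSwinnertonDyer.BirchSwinnertonDyer.Theorems.SignedEC.N2Levels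

end
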